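import Literature.IUT.HodgeTheaters.PiAvatarKitCoreThetaS5LocalWitness
import Literature.IUT.HodgeTheaters.GenuineFKitCor56iAtKit
import HarnessLib

/-!
# The ℱ-level core agreement `FKitCore` between abc-iut-L5-t3's §5-R4 data (the stub of ★ p497623) and the MERGE
# WINNER's GENUINE ℱ-kit `genuineFKitOfBadLocal … I` (★ p496697) EXISTS IF AND ONLY IF the realified global side
# `I.m4` is rigid — refuted at the bare (m4), holds at the (m4) slot of record `I.overPhi`
# (cell abc-iut, seat abc-iut-w4-d054 gen 14, self-row «FKITCORE-AT-GENUINE-FKIT»; PROOF-ONLY)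

S. Mochizuki, *Inter-universal Teichmüller theory I*, kurims manuscript (May 2020): Def 5.2 (i)–(iv) pp. 134–135
(`ℱ`-prime-strips; (iv) the realified global data `‡𝔉^⊩`), Rmk 5.2.1 (i)(ii) p. 143 (`𝔉 ↦ 𝔇`, `𝔉 ↦ 𝔉^⊩` «from the rigidity of
the divisor monoids»), Def 3.6 / Rmk 3.6.2 p. 87 (Θ-Hodge theaters and their isomorphisms), p. 147 («the `ℱ`-prime-strip
tautologically associated to this Θ-Hodge theater»), Cor 5.6 (i) p. 153, Ex 3.5 (i)(ii) pp. 84–86 (`𝒞⊩_mod`)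
([IUTchI] Def 5.2 (i) p.134) [claim: Mochizuki2012, status: disputed] (D-0012 claim key, series status DISPUTED — a DECISION
about the junction of two of the cell's typings over abc-iut-L5-t2's REAL `InitialThetaData`; nothing of the series is asserted,
no side is taken on [IUTchIII] Cor. 3.12).

## What is decided, and why it matters

abc-iut-L5-t3's bridge structure `BaseThetaDatum.S5Local.FKitCore S c FK` (`FKitCoreBridge.lean`) is the dictionary through which
every §6 statement typed over abc-iut-L5-t5's kits reads abc-iut-L5-t3's Definition-5.5 data: fully faithful comparison functors of the
local ambient categories (Def 5.2 (i)), a comparison `ht` of Θ-Hodge theaters BIJECTIVE ON ISOMORPHISMS (`htIso_bijective`,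
Rmk 3.6.2), and the naturality of the tautologically associated strips (p. 147).  Its KIT-RULE inhabitants in the tree are all
over abc-iut-w5-d217's `FKit.ofBase` («ℱ-data := isomorphs of the 𝒟-data», realified data := bare families): abc-iut-w5-d217's
`thickFKitCore`, abc-iut-L5-t5's `FKitCore.ofKitCore` (p442128), this base's `fKitCoreThetaStandIn` / `fKitCoreThetaOfBadPairs`
(★ p497623).  After «MERGE WON: C» (abc-iut-L5-lead 2026-08-27T04:46:26Z) the `ℱ`-kit of record over the genuine §6 base kit
`baseKitThetaNFOfBadPairs … B ΛBad` is abc-iut-L5-t2's `genuineFKitOfBadLocal … ES I` (★ p496697): local fields those of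
`FKit.ofBase` (σ3 label «isomorphisms of collections of data READ AS isomorphisms of their bases»), realified ambient
`RlfAmb := I.m4.Glob × ∏_x (isomorphs of 𝒟_x)` with model `(I.m4.gModel, models)` — the (m4) hub object enters.

THIS FILE decides, for the §5-R4 stub `S := D.s5LocalThetaOfBadPairs … ES` over the frozen identity core
`c := D.kitCoreThetaOfBadPairs … ES` (`e = id`), WHEN an `FKitCore S c (genuineFKitOfBadLocal … ES I)` exists:

* `nonempty_fKitCore_genuineFKitOfBadLocal_of_subsingleton` — IF `Aut_{I.m4.Glob}(I.m4.gModel)` is trivial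
  (`Subsingleton (I.m4.gModel ≅ I.m4.gModel)`), the p442128 construction goes through VERBATIM with the Θ-Hodge theater of a
  family `X` read as `(th := X, rlf := (I.m4.gModel, X))`: `htIso` is surjective EXACTLY because the `Glob`-component of an
  isomorphism of realified data is forced to be the identity;
* `subsingleton_of_fKitCore_genuineFKitOfBadLocal` — CONVERSELY, for ANY candidate agreement `fc` (any comparison functors, any
  `ht`): `assoc_natural` + faithfulness of `famb` make an isomorphism `φ` of stub Θ-Hodge theaters with trivial local image trivial,
  while `⟨thIso := 1, rlfIso := ρ (g × 1) ρ⁻¹⟩` is an isomorphism of the term's Θ-Hodge theater `fc.ht X` for EVERY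
  `g ∈ Aut(I.m4.gModel)` — the compatibility `compat` of Rmk 3.6.2 only sees the `ℱ^⊢`-components (`rlfFm = snd ⋙ eval`), never the
  `Glob` factor; surjectivity of `htIso` then forces `g = 1`;
* `nonempty_fKitCore_genuineFKitOfBadLocal_iff` — the bridge exists IFF the realified global side is rigid;
* INSTANCES BY NAME: `not_nonempty_fKitCore_genuineFKitOfBadLocal_bareModuli` — REFUTED at the bare (m4) inhabitant
  `realifiedGlobalSideOfModuli` (★ p497530; `Aut` nontrivial by abc-iut-L1-t3's Frobenius self-equivalence ★ p499823 through
  abc-iut-L5-t2's `exists_catAut_rlfArithCat_ne_one`), and `nonempty_fKitCore_genuineFKitOfBadLocal_overPhi` — HOLDS at the (m4) slot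
  of record `I.overPhi` (★ p500041 `subsingleton_end_gModel_ofNumberFieldOverPhi`: rigidity OVER `F_{Φ^rlf}`, abc-iut-L1-t3 ★ p496532;
  abc-iut-L5-lead RULINGS #120 (1)(b)).

So the same (m4) rigidity that abc-iut-L5-lead's RULINGS #120 (1) isolated for the Cor 5.6 (i) row `RlfIsoFaithful` is, in the kernel,
the EXACT condition for abc-iut-L5-t3's Definition-5.5 data to core-agree with the genuine `ℱ`-kit at all; row R61
«COR56I-AT-GENUINE-KIT» (abc-iut-L5-t13 ★ p502784 `GenuineFKitCor56iAtKit`) decided `Cor56iKit`/`Cor56iKitCanonical`/`RlfIsoFaithful` AT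
THE TERM by the same criterion and is consumed BY NAME, not restated: `nonempty_fKitCore_genuineFKitOfBadLocal_iff_cor56iKit` — the
bridge exists IFF abc-iut-w5-d217's kit-form Cor 5.6 (i) holds at the term (§5).  HONEST LABELS carried:
the stub takes `ℱ := 𝒟` (p442128: a consistency device, not print's Frobenioid-theoretic `ℱ`-data); the term's σ3 label travels; a
decision about OUR two typings' junction modulo the displayed binders {`CG`, `hS`, `M`, `hA`, `hI`, `B`, `ΛBad`, `ES`, `I`} is not
print's Cor 5.6 (i); universe `0` throughout (the genuine local records force it, ★ p496697 module docstring), so abc-iut-L5-t5's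
`S5Local.ofDatum` (successor universe) is NOT instantiated here.  PROOF-ONLY: no definition, instance, notation or `Prop` fact;
every `theorem` is kernel-checked; typed ≠ inhabited ≠ proved; nothing here asserts that abc is proved or refuted.
-/

namespace Literature.IUT.HodgeTheaters

open CategoryTheory

variable {F K Fbar : Type} [Field F] [NumberField F] [Field K] [NumberField K] [Algebra F K]
  [Field Fbar] [Algebra F Fbar] [Algebra K Fbar] {E : WeierstrassCurve F}
  [E.IsElliptic] {l : ℕ} {Pb : BadPlacePredicates K}
  (D : InitialThetaData F K Fbar E l Pb) (CG : D.geom.pe.CuspGalois) (hS : D.CuspClassesNormaliserStable) [Fact l.Prime]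
  (M : D.TorsionMonodromy) (hA : D.geom.pe.ArrowCoveringClaims)
  (hI : ∀ k ∈ D.geom.pe.inertia D.geom.pe.ε1, M.tau (D.geom.embK k) = 0)
  (B : ∀ v, v ∈ D.indexCopyBad → D.BadPairAt v) (ΛBad : ∀ v (h : v ∈ D.indexCopyBad), D.LocalArrowLaw CG hS (B v h).H)

namespace InitialThetaData

variable {Gv : D.IndexCopy → Subgroup (Fbar ≃ₐ[F] Fbar)}
  (ES : ∀ v, v ∈ D.indexCopyBad → EvalSectionBinder (D.localDataOfBadPairs CG hS M hA hI B ΛBad v) (Gv v))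
  (I : D.MergeInputs B)

/-! ### §1. Rigid (m4) ⇒ the core agreement exists (the p442128 construction at the genuine ℱ-kit) -/

/-- **IF the realified global side is rigid, abc-iut-L5-t3's §5-R4 stub core-agrees with the GENUINE `ℱ`-kit.**  Over the frozen
identity core `kitCoreThetaOfBadPairs … ES`, with `Subsingleton (I.m4.gModel ≅ I.m4.gModel)`: comparison functors and `baseComm`
identities (the term's local fields ARE `FKit.ofBase`'s), a family `X` of isomorphs of the `𝒟_x` read as the structured Θ-Hodge
theater `(th := X, rlf := (I.m4.gModel, X), rlf_fm := 1)` of the term, an isomorphism of families `φ` as `(φ, (1, φ))`; `htIso` is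
injective by its family component and SURJECTIVE because the `Glob`-component of any isomorphism of realified data is `1` (the
hypothesis) while its family component is pinned by `compat`; associated strips literally equal (abc-iut-L5-t5 p442128 /
abc-iut-w5-d217 `htOfFamily` pattern, verbatim but for the `Glob` factor). ([IUTchI] Def 5.2 (i) p.134) [claim: Mochizuki2012, status: disputed] -/
theorem nonempty_fKitCore_genuineFKitOfBadLocal_of_subsingleton
    (hm4 : letI := I.m4.cat; Subsingleton (I.m4.gModel ≅ I.m4.gModel)) :
    Nonempty ((D.s5LocalThetaOfBadPairs CG hS M hA hI B ΛBad ES).FKitCore (D.kitCoreThetaOfBadPairs CG hS M hA hI B ΛBad ES)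
      (D.genuineFKitOfBadLocal CG hS M hA hI B ΛBad ES I)) := by
  letI := I.m4.cat
  refine ⟨{ famb := fun _ => 𝟭 _
            fambFF := fun _ => Functor.FullyFaithful.id _
            fambModel := fun _ => Iso.refl _
            baseComm := fun _ => Iso.refl _
            ht := fun X =>
              { th := X.of
                th_isModel := fun x => ⟨ObjectProperty.isoMk _ (X.of x).property.some⟩
                rlf := (I.m4.gModel, X.of)
                rlf_isModel := ⟨Iso.prod (Iso.refl _) (Pi.isoMk fun x => ObjectProperty.isoMk _ (X.of x).property.some)⟩
                rlf_fm := fun _ => Iso.refl _ }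
            htIso := fun φ =>
              { thIso := fun x => Pi.isoApp φ.hom.iso x
                rlfIso := Iso.prod (Iso.refl _) φ.hom.iso
                compat := fun x => by
                  change φ.hom.iso.hom x ≫ 𝟙 _ = 𝟙 _ ≫ φ.hom.iso.hom x
                  rw [Category.comp_id, Category.id_comp] }
            htIso_bijective := ?_
            assocIso := fun _ _ => Iso.refl _
            assoc_natural := fun φ x => by
              change (Pi.isoApp φ.hom.iso x).hom ≫ 𝟙 _ = 𝟙 _ ≫ (Pi.isoApp φ.hom.iso x).hom
              rw [Category.comp_id, Category.id_comp] }⟩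
  intro X Y
  constructor
  · intro φ ψ h
    have h2 := congrArg PMBaseKit.FKit.ThetaHT.Iso.thIso h
    exact Iso.ext (Core.hom_ext (funext fun x => congrArg Iso.hom (congrFun h2 x)))
  · rintro ⟨t, r, hc⟩
    -- the `Glob`-component of `r` is the identity (rigidity), its family component is pinned by `compat`
    have h1 : r.hom.1 = 𝟙 I.m4.gModel :=
      congrArg Iso.hom (@Subsingleton.elim _ hm4 ((CategoryTheory.Prod.fst _ _).mapIso r) (Iso.refl _))
    have ht : ∀ x, r.hom.2 x = (t x).hom := fun x => by
      have hx := hc x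
      change r.hom.2 x ≫ 𝟙 _ = 𝟙 _ ≫ (t x).hom at hx
      rwa [Category.comp_id, Category.id_comp] at hx
    refine ⟨Core.isoMk ((CategoryTheory.Prod.snd _ _).mapIso r), PMBaseKit.FKit.ThetaHT.Iso.ext_of_thIso_rlfIso ?_ ?_⟩
    · funext x
      refine Iso.ext ?_
      change ((CategoryTheory.Prod.snd _ _).mapIso r).hom x = (t x).hom
      exact ht x
    · refine Iso.ext (Prod.ext ?_ ?_)
      · exact h1.symm
      · rfl

/-! ### §2. Conversely: a core agreement forces the (m4) to be rigid -/

/-- **A core agreement with the genuine `ℱ`-kit FORCES `Aut(I.m4.gModel) = 1`** — for ANY `fc` (any comparison functors, any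
comparison of Θ-Hodge theaters).  Fix the stub's model Θ-Hodge theater `X` and `H := fc.ht X`, `ρ : H.rlf ≅ (I.m4.gModel, models)`.
For every `g ∈ Aut(I.m4.gModel)`, `Ψ g := ⟨thIso := 1, rlfIso := ρ ≪≫ (g × 1) ≪≫ ρ⁻¹⟩` IS an isomorphism `H ⥲ H` of the term's Θ-Hodge
theaters: the compatibility of Rmk 3.6.2 reads the realified datum only through `rlfFm x = snd ⋙ eval x`, which kills the `Glob`
factor.  By `htIso_bijective` some `φ_g : X ≅ X` maps to `Ψ g`; by `assoc_natural` (p. 147 naturality of the associated strips) and the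
faithfulness of `famb`, an isomorphism of stub theaters whose image has trivial local part is itself trivial — so `φ_g = 1 = φ_1`,
whence `Ψ g = Ψ 1` and `g = 1`. ([IUTchI] Rmk 5.2.1 (ii) p.143) [claim: Mochizuki2012, status: disputed] -/
theorem subsingleton_of_fKitCore_genuineFKitOfBadLocal
    (fc : (D.s5LocalThetaOfBadPairs CG hS M hA hI B ΛBad ES).FKitCore (D.kitCoreThetaOfBadPairs CG hS M hA hI B ΛBad ES)
      (D.genuineFKitOfBadLocal CG hS M hA hI B ΛBad ES I)) :
    letI := I.m4.cat; Subsingleton (I.m4.gModel ≅ I.m4.gModel) := by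
  letI := I.m4.cat
  have key : ∀ g : I.m4.gModel ≅ I.m4.gModel, g = Iso.refl _ := by
    intro g
    let X := (D.s5LocalThetaOfBadPairs CG hS M hA hI B ΛBad ES).HT
    let H := fc.ht X
    let ρ : H.rlf ≅ (D.genuineFKitOfBadLocal CG hS M hA hI B ΛBad ES I).rlfModel := H.rlf_isModel.some
    -- the isomorphism of `H` with trivial local part and `Glob`-part `g'`
    let Ψ : (I.m4.gModel ≅ I.m4.gModel) → PMBaseKit.FKit.ThetaHT.Iso H H := fun g' =>
      { thIso := fun _ => Iso.refl _
        rlfIso := ρ ≪≫ Iso.prod g' (Iso.refl _) ≪≫ ρ.symm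
        compat := fun x => by
          -- `rlfFm x = snd ⋙ eval x` kills the `Glob` factor: the `ℱ^⊢`-component of `ρ (g' × 1) ρ⁻¹` at `x` is `ρ_x ρ_x⁻¹ = 1`
          have hρ : ρ.hom.2 x ≫ ρ.inv.2 x = 𝟙 _ := congrArg (fun f => f.2 x) ρ.hom_inv_id
          change (ρ.hom.2 x ≫ (𝟙 _ ≫ ρ.inv.2 x)) ≫ (H.rlf_fm x).hom = (H.rlf_fm x).hom ≫ 𝟙 _
          rw [Category.id_comp, hρ, Category.id_comp, Category.comp_id] }
    -- an isomorphism of stub theaters whose image has trivial local part is trivial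
    have hφ : ∀ φ : X ≅ X, (∀ x, (fc.htIso φ).thIso x = Iso.refl _) → φ = Iso.refl X := by
      intro φ hth
      refine Iso.ext (Core.hom_ext ?_)
      change φ.hom.iso.hom = 𝟙 X.of
      funext x
      have hn := fc.assoc_natural φ x
      rw [hth x, Functor.mapIso_refl, Iso.refl_hom, Category.comp_id] at hn
      have h1 : (fc.famb x).map
          ((D.s5LocalThetaOfBadPairs CG hS M hA hI B ΛBad ES).assocStripIso φ
            ((D.kitCoreThetaOfBadPairs CG hS M hA hI B ΛBad ES).e x)).hom = 𝟙 _ := by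
        simpa [Category.assoc] using congrArg (· ≫ (fc.assocIso X x).inv) hn
      have h2 := (fc.fambFF x).map_injective (h1.trans ((fc.famb x).map_id _).symm)
      exact h2
    obtain ⟨φ₁, h₁⟩ := (fc.htIso_bijective X X).2 (Ψ (Iso.refl _))
    obtain ⟨φ₂, h₂⟩ := (fc.htIso_bijective X X).2 (Ψ g)
    have e₁ : φ₁ = Iso.refl X := hφ φ₁ fun x => (congrArg (fun e => e.thIso x) h₁).trans rfl
    have e₂ : φ₂ = Iso.refl X := hφ φ₂ fun x => (congrArg (fun e => e.thIso x) h₂).trans rfl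
    have hΨ : Ψ (Iso.refl _) = Ψ g := by rw [← h₁, ← h₂, e₁, e₂]
    -- read off the `Glob`-components: cancel `ρ`, `ρ⁻¹` and take the first factor
    have hr := congrArg (fun e : PMBaseKit.FKit.ThetaHT.Iso H H => e.rlfIso.hom) hΨ
    change ρ.hom ≫ ((Iso.prod (Iso.refl I.m4.gModel) (Iso.refl _)).hom ≫ ρ.inv) =
      ρ.hom ≫ ((Iso.prod g (Iso.refl _)).hom ≫ ρ.inv) at hr
    have hP := (cancel_mono ρ.inv).1 ((cancel_epi ρ.hom).1 hr)
    exact Iso.ext (congrArg (fun f => f.1) hP).symm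
  exact ⟨fun a b => (key a).trans (key b).symm⟩

/-! ### §3. The decision -/

/-- **abc-iut-L5-t3's §5-R4 stub core-agrees with the GENUINE `ℱ`-kit `genuineFKitOfBadLocal … I` IF AND ONLY IF the realified global side
`I.m4` is rigid** (`Aut_{I.m4.Glob}(I.m4.gModel) = 1` — print's «rigidity of the divisor monoids», Rmk 5.2.1 (ii), is exactly what the
junction needs of the (m4) hub object). ([IUTchI] Rmk 5.2.1 (ii) p.143) [claim: Mochizuki2012, status: disputed] -/
theorem nonempty_fKitCore_genuineFKitOfBadLocal_iff :
    Nonempty ((D.s5LocalThetaOfBadPairs CG hS M hA hI B ΛBad ES).FKitCore (D.kitCoreThetaOfBadPairs CG hS M hA hI B ΛBad ES)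
      (D.genuineFKitOfBadLocal CG hS M hA hI B ΛBad ES I)) ↔
    (letI := I.m4.cat; Subsingleton (I.m4.gModel ≅ I.m4.gModel)) :=
  ⟨fun ⟨fc⟩ => D.subsingleton_of_fKitCore_genuineFKitOfBadLocal CG hS M hA hI B ΛBad ES I fc,
    D.nonempty_fKitCore_genuineFKitOfBadLocal_of_subsingleton CG hS M hA hI B ΛBad ES I⟩

/-! ### §4. Instances by name: refuted at the bare (m4), holds at the (m4) slot of record -/

/-- **REFUTED at the bare (m4) inhabitant**: with `I.m4 := realifiedGlobalSideOfModuli D` (★ p497530, `Glob = SingleObj (CatAut 𝒞⊩_mod)`)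
NO core agreement between the stub and the genuine `ℱ`-kit exists — `Aut(𝒞⊩_mod)` in the §0 sense is nontrivial (abc-iut-L1-t3's Frobenius
self-equivalence `powFunctor 2 ≇ 𝟭`, ★ p499823, through abc-iut-L5-t2's `exists_catAut_rlfArithCat_ne_one`).  The bare inhabitant witnesses
NON-VACUITY of (m4) only (abc-iut-L5-lead RULINGS #120 (1)(a)). ([IUTchI] Ex 3.5 (i) p.84) [claim: Mochizuki2012, status: disputed] -/
theorem not_nonempty_fKitCore_genuineFKitOfBadLocal_bareModuli :
    ¬ Nonempty ((D.s5LocalThetaOfBadPairs CG hS M hA hI B ΛBad ES).FKitCore (D.kitCoreThetaOfBadPairs CG hS M hA hI B ΛBad ES)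
      (D.genuineFKitOfBadLocal CG hS M hA hI B ΛBad ES (I.withM4 D.realifiedGlobalSideOfModuli))) := by
  rintro ⟨fc⟩
  have hsub := D.subsingleton_of_fKitCore_genuineFKitOfBadLocal CG hS M hA hI B ΛBad ES (I.withM4 D.realifiedGlobalSideOfModuli) fc
  obtain ⟨c, hc⟩ := exists_catAut_rlfArithCat_ne_one (fieldOfModuli E)
  letI := (I.withM4 D.realifiedGlobalSideOfModuli).m4.cat
  -- the automorphism of `⋆ ∈ SingleObj (CatAut 𝒞⊩_mod)` named by `c` (every morphism of the one-object kind of a group is invertible)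
  have hg := @Subsingleton.elim _ hsub
    ((Groupoid.isoEquivHom (SingleObj.star (CatAut (rlfArithCat (fieldOfModuli E)))) (SingleObj.star _)).symm c) (Iso.refl _)
  exact hc (congrArg Iso.hom hg)

/-- **HOLDS at the (m4) slot of record**: with the realified global side keyed OVER `F_{Φ^rlf}` (`I.overPhi`, ★ p500041 — every endomorphism of
`𝒞⊩_mod` in `Glob` is the identity, `subsingleton_end_gModel_ofNumberFieldOverPhi`, from abc-iut-L1-t3's rigidity over the structure functor
★ p496532) the §5-R4 stub DOES core-agree with the genuine `ℱ`-kit: `FKitCore` is INHABITED at a genuine (non-`FKit.ofBase`) `ℱ`-kit for the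
first time in the tree. ([IUTchI] Def 5.2 (iv) p.135) [claim: Mochizuki2012, status: disputed] -/
theorem nonempty_fKitCore_genuineFKitOfBadLocal_overPhi :
    Nonempty ((D.s5LocalThetaOfBadPairs CG hS M hA hI B ΛBad ES).FKitCore (D.kitCoreThetaOfBadPairs CG hS M hA hI B ΛBad ES)
      (D.genuineFKitOfBadLocal CG hS M hA hI B ΛBad ES I.overPhi)) :=
  D.nonempty_fKitCore_genuineFKitOfBadLocal_of_subsingleton CG hS M hA hI B ΛBad ES I.overPhi
    (by
      letI := I.overPhi.m4.cat
      exact ⟨fun a b => Iso.ext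
        (@Subsingleton.elim _ (subsingleton_end_gModel_ofNumberFieldOverPhi (fieldOfModuli E)) a.hom b.hom)⟩)

/-- **The decision at the two (m4) inhabitants of record, packaged**: the stub ↔ genuine-`ℱ`-kit core agreement FAILS at the bare `𝒞⊩_mod`
kind and HOLDS at the kind keyed over `F_{Φ^rlf}` — the kernel form of abc-iut-L5-lead RULINGS #120 (1) «(a) bare-CatAut m4: NO ⊩-side reading;
(b) the m4 SLOT OF RECORD = Glob keyed OVER F_{Φ^rlf}» for the `FKitCore` junction. ([IUTchI] Rmk 5.2.1 (ii) p.143) [claim: Mochizuki2012, status: disputed] -/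
theorem fKitCore_genuineFKitOfBadLocal_decided :
    (¬ Nonempty ((D.s5LocalThetaOfBadPairs CG hS M hA hI B ΛBad ES).FKitCore (D.kitCoreThetaOfBadPairs CG hS M hA hI B ΛBad ES)
        (D.genuineFKitOfBadLocal CG hS M hA hI B ΛBad ES (I.withM4 D.realifiedGlobalSideOfModuli)))) ∧
      Nonempty ((D.s5LocalThetaOfBadPairs CG hS M hA hI B ΛBad ES).FKitCore (D.kitCoreThetaOfBadPairs CG hS M hA hI B ΛBad ES)
        (D.genuineFKitOfBadLocal CG hS M hA hI B ΛBad ES I.overPhi)) :=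
  ⟨D.not_nonempty_fKitCore_genuineFKitOfBadLocal_bareModuli CG hS M hA hI B ΛBad ES I,
    D.nonempty_fKitCore_genuineFKitOfBadLocal_overPhi CG hS M hA hI B ΛBad ES I⟩

/-! ### §5. Junction with row R61 (abc-iut-L5-t13 ★ p502784): the bridge exists iff Cor 5.6 (i) holds at the term -/

/-- **The §5-R4 stub core-agrees with the genuine `ℱ`-kit IF AND ONLY IF abc-iut-w5-d217's kit-form [IUTchI] Cor 5.6 (i) `FKit.Cor56iKit`
HOLDS at that kit** — both are equivalent to the rigidity of the (m4) model (this file's `…_iff` and abc-iut-L5-t13's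
`genuineFKitOfBadLocal_cor56iKit_iff`, ★ p502784, BY NAME).  So at the merge of record the existence of abc-iut-L5-t3's ℱ-level
dictionary and the Cor 5.6 (i) reading are ONE condition («rigidity of the divisor monoids», Rmk 5.2.1 (ii), over `F_{Φ^rlf}`); holds-at-kit
≠ proved in print. ([IUTchI] Cor 5.6 (i) p.153) [claim: Mochizuki2012, status: disputed] -/
theorem nonempty_fKitCore_genuineFKitOfBadLocal_iff_cor56iKit :
    Nonempty ((D.s5LocalThetaOfBadPairs CG hS M hA hI B ΛBad ES).FKitCore (D.kitCoreThetaOfBadPairs CG hS M hA hI B ΛBad ES)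
      (D.genuineFKitOfBadLocal CG hS M hA hI B ΛBad ES I)) ↔
    (D.genuineFKitOfBadLocal CG hS M hA hI B ΛBad ES I).Cor56iKit :=
  (D.nonempty_fKitCore_genuineFKitOfBadLocal_iff CG hS M hA hI B ΛBad ES I).trans
    (D.genuineFKitOfBadLocal_cor56iKit_iff CG hS M hA hI B ΛBad ES I).symm

/-- **Hence, whenever the bridge exists, abc-iut-L5-t3's frozen node statement `S5Local.Cor56i` of the stub is ALSO obtained THROUGH the
genuine kit** (abc-iut-w5-d217's junction `FKitCore.cor56i_of_cor56iKit` fed with the term's `Cor56iKit` — from the previous theorem — and its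
Cor 5.3 (ii) tautology `genuineFKitOfBadLocal_isomFtoDBijective`, `e = id`), in agreement with the direct instance `cor56i_s5LocalThetaOfBadPairs`
(★ p497623) over `FKit.ofBase`: the two routes to the node statement at the stub coincide in verdict. ([IUTchI] Cor 5.6 (i) p.153)
[claim: Mochizuki2012, status: disputed] -/
theorem cor56i_s5LocalThetaOfBadPairs_of_fKitCore_genuine
    (fc : (D.s5LocalThetaOfBadPairs CG hS M hA hI B ΛBad ES).FKitCore (D.kitCoreThetaOfBadPairs CG hS M hA hI B ΛBad ES)
      (D.genuineFKitOfBadLocal CG hS M hA hI B ΛBad ES I)) :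
    BaseThetaDatum.S5Local.Cor56i (D.s5LocalThetaOfBadPairs CG hS M hA hI B ΛBad ES) :=
  fc.cor56i_of_cor56iKit Function.surjective_id
    ((D.nonempty_fKitCore_genuineFKitOfBadLocal_iff_cor56iKit CG hS M hA hI B ΛBad ES I).1 ⟨fc⟩)
    (D.genuineFKitOfBadLocal_isomFtoDBijective CG hS M hA hI B ΛBad ES I)

end InitialThetaData

end Literature.IUT.HodgeTheaters
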